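import Mathlib
import Summits.ResolutionOfSingularities.ResolutionOfSingularities.Theorems.SyzygyFlatteningDefs
import Summits.ResolutionOfSingularities.ResolutionOfSingularities.Theorems.SyzygyFlatteningHigherRankTerminationTowerStageBasic
import Summits.ResolutionOfSingularities.ResolutionOfSingularities.Theorems.SyzygyFlatteningHigherRankTerminationLocAt
import Summits.ResolutionOfSingularities.ResolutionOfSingularities.Theorems.SyzygyFlatteningHigherRankTerminationRegularStep
import Summits.ResolutionOfSingularities.ResolutionOfSingularities.Theorems.SyzygyFlatteningHigherRankTerminationNrmLocAt
import Summits.ResolutionOfSingularities.ResolutionOfSingularities.Theorems.SyzygyFlatteningHigherRankTerminationSingIdealLocAt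
import Summits.ResolutionOfSingularities.ResolutionOfSingularities.Theorems.SyzygyFlatteningHigherRankTerminationNormIdealIndep
import Summits.ResolutionOfSingularities.ResolutionOfSingularities.Theorems.SyzygyFlatteningHigherRankTerminationExistsMinimalDatum
import Summits.ResolutionOfSingularities.ResolutionOfSingularities.Theorems.SyzygyFlatteningHigherRankTerminationChartCanonical
import Summits.ResolutionOfSingularities.ResolutionOfSingularities.Theorems.SyzygyFlatteningHigherRankTerminationLocalizedDatum
import Summits.ResolutionOfSingularities.ResolutionOfSingularities.Theorems.SyzygyFlatteningHigherRankTerminationEssFiniteType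
import Literature.AlgebraicGeometry.Resolution.RankOneReductionProofs
import HarnessLib

/-!
# The syzygy-flattening operator commutes with coarsening (`stub_towerLocalisation`)

Crux `SyzygyFlattening.HigherRankTermination` (stmt-ResolutionOfSingularities-17045), line `birth`,
registered stub `stub_towerLocalisation` — PROVED: for valuation rings `k ⊆ O ≤ O₁` of `K` and an
affine model `A ⊆ O` with `Frac A = K`, the tower along the coarsening `O₁` is the tower along
`O` localised at the centres of `ν₁`:
`locAt O₁ (tower O A m) = tower O₁ A m` for every `m`.

Assembled from the wave-1/wave-2 infrastructure of the line (all landed under `Theorems/`):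
`stub_locAt_locAt` (stage 0 and idempotence), `stub_regularStep` (regular stages are fixed
points), `stub_towerStage_basic`, `stub_nrm_locAt` (normalisation commutes with localisation),
`stub_singIdeal_locAt` (the non-regular locus localises — openness of `Reg` over any field),
`stub_normIdeal_indep` (the ideal of maximal minors of an embedded syzygy module is independent of
the resolution and the embedding up to `K^×` — Schanuel, free summands, embeddings),
`stub_exists_minimalDatum`, `stub_chart_canonical` (one datum and one minimal minor compute the
chart after localising), `stub_localizedDatum` (a minimal datum localises),
`stub_essFiniteType_locAt/_nrm/_adjoinRatios` (stages stay essentially of finite type).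

Also proved here, for the skeleton: `locAt_tower` (stages are closed under `locAt O`),
`isFractionRing_tower`, `tower_eq_of_regular` (a regular stage is terminal), `locAt_step_eq`
(ONE STEP IN CANONICAL FORM: `locAt O₁ (step O B) = locAt O₁ (nrm (B[det ι g / det ι x]))` for
any qualifying datum and `O`-minimal `x`), `essFiniteType_tower` (every stage is essentially of
finite type over `k`, hence noetherian), `towerLocalisation`, and
`eventuallyRegularAlong_of_towerTerminates` (termination along a coarsening `O₁ ⊇ O` gives
eventual persistent regularity of the `O`-tower at the centre of `O₁` — the v1 stub
`stub_coarseningLocalisation` of the planner's skeleton, now a theorem).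

References: Novacoski–Spivakovsky 2014, Lemma 2.5 (1) and Cor. 2.14 (the existential shadow of
tower localisation); Villamayor 2006, 3.4 (charts of the blow-up at a module); Matsumura §19
(localisation of finite free resolutions).
-/

noncomputable section

-- single-problem summit: the doubled namespace component `ResolutionOfSingularities` is forced
set_option linter.dupNamespace false

namespace Summit.ResolutionOfSingularities.ResolutionOfSingularities.Theorems.SyzygyFlattening

/-! ### Proved glue, part 1: stages, fixed points -/

section glue

variable {k K : Type} [Field k] [Field K] [Algebra k K]

/-- Every stage is closed under `locAt O`: `locAt O (tower O A m) = tower O A m`. [folklore] -/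
theorem locAt_tower (O : ValuationSubring K) (A : Subalgebra k K)
    (hk : ∀ c : k, algebraMap k K c ∈ O) (hAO : A.toSubring ≤ O.toSubring) (m : ℕ) :
    locAt O (tower O A m) = tower O A m := by
  cases m with
  | zero => exact locAt_locAt O A hAO
  | succ m =>
    exact locAt_locAt O _
      (nrm_toSubring_le O hk (chart_toSubring_le O hk (tower_toSubring_le O hk hAO m)))

/-- Every stage has fraction field `K` (it contains `A`). [folklore] -/
theorem isFractionRing_tower (O : ValuationSubring K) (A : Subalgebra k K)
    (hFrac : IsFractionRing ↥A K) (m : ℕ) : IsFractionRing ↥(tower O A m) K :=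
  haveI := hFrac
  Literature.AlgebraicGeometry.Resolution.isFractionRing_subalgebra_of_le A (tower O A m)
    (self_le_tower O A m)

/-- **A regular stage is terminal**: if `tower O A m` is regular then every later stage equals
it (`stub_regularStep`). [folklore] -/
theorem tower_eq_of_regular (O : ValuationSubring K) (A : Subalgebra k K)
    (hk : ∀ c : k, algebraMap k K c ∈ O) (hFrac : IsFractionRing ↥A K)
    (hAO : A.toSubring ≤ O.toSubring) (m : ℕ) (hreg : IsRegularLocalRing ↥(tower O A m)) :
    ∀ j : ℕ, tower O A (m + j) = tower O A m := by
  intro j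
  induction j with
  | zero => rfl
  | succ j ih =>
    rw [← add_assoc, tower_succ', ih]
    exact stub_regularStep k K O (tower O A m) hk (tower_toSubring_le O hk hAO m)
      (isFractionRing_tower O A hFrac m) (locAt_tower O A hk hAO m) hreg

end glue

/-! ### Proved glue, part 2: the operator commutes with coarsening (`stub_towerLocalisation`
from the wave-2 stubs) -/

section towerLocalisation

variable {k K : Type} [Field k] [Field K] [Algebra k K]

/-- A subalgebra generated by `B ⊆ O` and ratios lying in `O` lies in any `O₁ ≥ O`.
[folklore] -/
theorem adjoin_ratios_le (O O₁ : ValuationSubring K) (hOO₁ : O ≤ O₁) (B : Subalgebra k K)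
    (hk : ∀ c : k, algebraMap k K c ∈ O) (hB : B.toSubring ≤ O.toSubring) (S : Set K)
    (hS : S ⊆ O) : (Algebra.adjoin k ((B : Set K) ∪ S)).toSubring ≤ O₁.toSubring := by
  refine adjoin_toSubring_le_valuationSubring O₁ (fun c => hOO₁ (hk c)) ?_
  rintro y (hy | hy)
  · exact hOO₁ (hB (Subalgebra.mem_toSubring.mpr hy))
  · exact hOO₁ (hS hy)

/-- The independence hypothesis of `stub_chart_canonical` for a model `B ⊆ K`, from
`stub_normIdeal_indep` (the coercion `↥B → K` is the injective `algebraMap`). [folklore] -/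
theorem indep_hyp (B : Subalgebra k K)
    (b : ℕ → ℕ) (d : (i : ℕ) → ((Fin (b (i + 1)) → ↥B) →ₗ[↥B] (Fin (b i) → ↥B)))
    (ε : (Fin (b 0) → ↥B) →ₗ[↥B] (↥B ⧸ singIdeal B)) (r : ℕ)
    (ι : ↥(LinearMap.range (d (syzygyIndex k K - 1))) →ₗ[↥B] (Fin r → ↥B))
    (hε : Function.Surjective ε) (h0 : Function.Exact (d 0) ε)
    (hs : ∀ i : ℕ, Function.Exact (d (i + 1)) (d i)) (hι : Function.Injective ι)
    (htors : ∀ z : Fin r → ↥B, ∃ a : ↥B, a ≠ 0 ∧ a • z ∈ LinearMap.range ι) :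
    ∀ (b' : ℕ → ℕ) (d' : (i : ℕ) → ((Fin (b' (i + 1)) → ↥B) →ₗ[↥B] (Fin (b' i) → ↥B)))
        (ε' : (Fin (b' 0) → ↥B) →ₗ[↥B] (↥B ⧸ singIdeal B)) (r' : ℕ)
        (ι' : ↥(LinearMap.range (d' (syzygyIndex k K - 1))) →ₗ[↥B] (Fin r' → ↥B)),
          Function.Surjective ε' → Function.Exact (d' 0) ε' → (∀ i : ℕ, Function.Exact (d' (i + 1)) (d' i)) →
        Function.Injective ι' → (∀ z : Fin r' → ↥B, ∃ a : ↥B, a ≠ 0 ∧ a • z ∈ LinearMap.range ι') →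
          ∃ c : K, c ≠ 0 ∧
            Submodule.span ↥B (Set.range fun g' : Fin r' → ↥(LinearMap.range (d' (syzygyIndex k K - 1))) =>
                Matrix.det (Matrix.of fun i j => ((ι' (g' i) j : ↥B) : K))) =
              (Submodule.span ↥B (Set.range fun g : Fin r → ↥(LinearMap.range (d (syzygyIndex k K - 1))) =>
                Matrix.det (Matrix.of fun i j => ((ι (g i) j : ↥B) : K)))).map
                (LinearMap.mulLeft ↥B c) := by
  intro b' d' ε' r' ι' hε' h0' hs' hι' htors'
  have hinj : Function.Injective (algebraMap ↥B K) := fun x y h => Subtype.ext h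
  exact stub_normIdeal_indep ↥B K hinj (↥B ⧸ singIdeal B) b d ε b' d' ε' hε h0 hs hε' h0' hs'
    (syzygyIndex k K - 1) r r' ι ι' hι hι' htors htors'

/-- **One step, in canonical form.** For a stage `B ⊆ O ≤ O₁` (noetherian, `Frac B = K`) and ANY
qualifying datum `(b, d, ε, r, ι)` with an `O`-minimal tuple `x`:
`locAt O₁ (step O B) = locAt O₁ (nrm (B[det ι g / det ι x]))`. From `stub_locAt_locAt`,
`stub_nrm_locAt` (twice), `stub_chart_canonical` and `stub_normIdeal_indep`. [folklore] -/
theorem locAt_step_eq (O O₁ : ValuationSubring K) (hOO₁ : O ≤ O₁) (B : Subalgebra k K)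
    (hk : ∀ c : k, algebraMap k K c ∈ O) (hB : B.toSubring ≤ O.toSubring)
    (b : ℕ → ℕ) (d : (i : ℕ) → ((Fin (b (i + 1)) → ↥B) →ₗ[↥B] (Fin (b i) → ↥B)))
    (ε : (Fin (b 0) → ↥B) →ₗ[↥B] (↥B ⧸ singIdeal B)) (r : ℕ)
    (ι : ↥(LinearMap.range (d (syzygyIndex k K - 1))) →ₗ[↥B] (Fin r → ↥B))
    (x : Fin r → ↥(LinearMap.range (d (syzygyIndex k K - 1))))
    (hε : Function.Surjective ε) (h0 : Function.Exact (d 0) ε)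
    (hs : ∀ i : ℕ, Function.Exact (d (i + 1)) (d i)) (hι : Function.Injective ι)
    (htors : ∀ z : Fin r → ↥B, ∃ a : ↥B, a ≠ 0 ∧ a • z ∈ LinearMap.range ι)
    (hx0 : Matrix.det (Matrix.of fun i j => ((ι (x i) j : ↥B) : K)) ≠ 0)
    (hmin : ∀ g' : Fin r → ↥(LinearMap.range (d (syzygyIndex k K - 1))),
      Matrix.det (Matrix.of fun i j => ((ι (g' i) j : ↥B) : K)) *
        (Matrix.det (Matrix.of fun i j => ((ι (x i) j : ↥B) : K)))⁻¹ ∈ O) :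
    locAt O₁ (step O B) =
      locAt O₁ (nrm (Algebra.adjoin k ((B : Set K) ∪
        {y : K | ∃ g : Fin r → ↥(LinearMap.range (d (syzygyIndex k K - 1))),
          y = Matrix.det (Matrix.of fun i j => ((ι (g i) j : ↥B) : K)) *
            (Matrix.det (Matrix.of fun i j => ((ι (x i) j : ↥B) : K)))⁻¹}))) := by
  have hk₁ : ∀ c : k, algebraMap k K c ∈ O₁ := fun c => hOO₁ (hk c)
  have hchart : (chart O B).toSubring ≤ O.toSubring := chart_toSubring_le O hk hB
  have hchart₁ : (chart O B).toSubring ≤ O₁.toSubring := fun y hy => hOO₁ (hchart hy)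
  have hnrm : (nrm (chart O B)).toSubring ≤ O.toSubring := nrm_toSubring_le O hk hchart
  -- the ratio set lies in `O`
  have hR : {y : K | ∃ g : Fin r → ↥(LinearMap.range (d (syzygyIndex k K - 1))),
      y = Matrix.det (Matrix.of fun i j => ((ι (g i) j : ↥B) : K)) *
        (Matrix.det (Matrix.of fun i j => ((ι (x i) j : ↥B) : K)))⁻¹} ⊆ O := by
    rintro y ⟨g, rfl⟩
    exact hmin g
  have hadj₁ := adjoin_ratios_le O O₁ hOO₁ B hk hB _ hR
  have hCF := stub_chart_canonical k K O O₁ B hk hOO₁ hB b d ε r ι x hε h0 hs hι htors hx0 hmin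
    (indep_hyp B b d ε r ι hε h0 hs hι htors)
  calc locAt O₁ (step O B)
      = locAt O₁ (nrm (chart O B)) := stub_locAt_locAt k K O O₁ _ hk hOO₁ hnrm
    _ = locAt O₁ (nrm (locAt O₁ (chart O B))) := (stub_nrm_locAt k K O₁ (chart O B) hk₁ hchart₁).symm
    _ = _ := by rw [hCF]
    _ = _ := stub_nrm_locAt k K O₁ _ hk₁ hadj₁

/-- Stage invariants of the `O`-tower: essentially of finite type over `k` (so noetherian), by
induction — each step is `locAt O ∘ nrm` of `B` with finitely many ratios adjoined
(`locAt_step_eq` with `O₁ = O`, `stub_exists_minimalDatum`, `stub_essFiniteType_*`). [folklore] -/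
theorem essFiniteType_tower (O : ValuationSubring K) (A : Subalgebra k K)
    (hk : ∀ c : k, algebraMap k K c ∈ O) (hFG : A.FG) (hFrac : IsFractionRing ↥A K)
    (hAO : A.toSubring ≤ O.toSubring) : ∀ m : ℕ, Algebra.EssFiniteType k ↥(tower O A m) := by
  intro m
  induction m with
  | zero =>
    haveI : Algebra.FiniteType k ↥A := (Subalgebra.fg_iff_finiteType A).mp hFG
    exact stub_essFiniteType_locAt k K O A hAO hFrac inferInstance
  | succ m ih =>
    set B := tower O A m with hBdef
    have hB : B.toSubring ≤ O.toSubring := tower_toSubring_le O hk hAO m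
    have hFracB : IsFractionRing ↥B K := isFractionRing_tower O A hFrac m
    haveI := ih
    have hNoeth : IsNoetherianRing ↥B := Algebra.EssFiniteType.isNoetherianRing k ↥B
    obtain ⟨b, d, ε, r, ι, hε, h0, hs, hι, htors, x, hx0, hmin⟩ :=
      stub_exists_minimalDatum k K O B hB hNoeth hFracB
    have hstep := locAt_step_eq O O le_rfl B hk hB b d ε r ι x hε h0 hs hι htors hx0 hmin
    -- `tower O A (m+1) = step O B = locAt O (step O B)`
    have hfix : locAt O (step O B) = step O B :=
      locAt_locAt O _ (nrm_toSubring_le O hk (chart_toSubring_le O hk hB))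
    rw [tower_succ', ← hBdef, ← hfix, hstep]
    -- the three finiteness stubs
    set C := Algebra.adjoin k ((B : Set K) ∪
        {y : K | ∃ g : Fin r → ↥(LinearMap.range (d (syzygyIndex k K - 1))),
          y = Matrix.det (Matrix.of fun i j => ((ι (g i) j : ↥B) : K)) *
            (Matrix.det (Matrix.of fun i j => ((ι (x i) j : ↥B) : K)))⁻¹}) with hCdef
    have hBC : B ≤ C := fun y hy => Algebra.subset_adjoin (Or.inl hy)
    have hC : Algebra.EssFiniteType k ↥C :=
      stub_essFiniteType_adjoinRatios k K B ih _ inferInstance r ι x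
    have hFracC : IsFractionRing ↥C K :=
      haveI := hFracB
      Literature.AlgebraicGeometry.Resolution.isFractionRing_subalgebra_of_le B C hBC
    have hN : Algebra.EssFiniteType k ↥(nrm C) := stub_essFiniteType_nrm k K C hFracC hC
    have hR : {y : K | ∃ g : Fin r → ↥(LinearMap.range (d (syzygyIndex k K - 1))),
        y = Matrix.det (Matrix.of fun i j => ((ι (g i) j : ↥B) : K)) *
          (Matrix.det (Matrix.of fun i j => ((ι (x i) j : ↥B) : K)))⁻¹} ⊆ O := by
      rintro y ⟨g, rfl⟩
      exact hmin g
    have hCO : C.toSubring ≤ O.toSubring := adjoin_ratios_le O O le_rfl B hk hB _ hR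
    have hNO : (nrm C).toSubring ≤ O.toSubring := nrm_toSubring_le O hk hCO
    have hFracN : IsFractionRing ↥(nrm C) K :=
      haveI := hFracC
      Literature.AlgebraicGeometry.Resolution.isFractionRing_subalgebra_of_le C (nrm C)
        (self_le_nrm C)
    exact stub_essFiniteType_locAt k K O (nrm C) hNO hFracN hN

/-- **`stub_towerLocalisation` from the wave-2 stubs**: for `O ≤ O₁` the tower along `O₁` is
the tower along `O` localised at the centres of `ν₁`. Induction on the stage: both sides of
stage `m + 1` are `locAt O₁ (nrm (B[N / det x]))` for one `O`-minimal datum of `B = tower O A m`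
(`locAt_step_eq` over `O ≤ O₁`, and over `O₁ ≤ O₁` for the localised datum of
`stub_localizedDatum`, whose `J`-localisation hypothesis is `stub_singIdeal_locAt`). -/
theorem towerLocalisation (O : ValuationSubring K) (A : Subalgebra k K)
    (hk : ∀ c : k, algebraMap k K c ∈ O) (hFG : A.FG) (hFrac : IsFractionRing ↥A K)
    (hAO : A.toSubring ≤ O.toSubring) (O₁ : ValuationSubring K) (hOO₁ : O ≤ O₁) :
    ∀ m : ℕ, locAt O₁ (tower O A m) = tower O₁ A m := by
  have hk₁ : ∀ c : k, algebraMap k K c ∈ O₁ := fun c => hOO₁ (hk c)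
  have hAO₁ : A.toSubring ≤ O₁.toSubring := fun y hy => hOO₁ (hAO hy)
  intro m
  induction m with
  | zero => exact stub_locAt_locAt k K O O₁ A hk hOO₁ hAO
  | succ m ih =>
    set B := tower O A m with hBdef
    have hB : B.toSubring ≤ O.toSubring := tower_toSubring_le O hk hAO m
    have hB₁ : B.toSubring ≤ O₁.toSubring := fun y hy => hOO₁ (hB hy)
    have hFracB : IsFractionRing ↥B K := isFractionRing_tower O A hFrac m
    haveI hEFT : Algebra.EssFiniteType k ↥B := essFiniteType_tower O A hk hFG hFrac hAO m
    have hNoeth : IsNoetherianRing ↥B := Algebra.EssFiniteType.isNoetherianRing k ↥B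
    -- a minimal datum over `B`, and its localisation over `locAt O₁ B`
    obtain ⟨b, d, ε, r, ι, hε, h0, hs, hι, htors, x, hx0, hmin⟩ :=
      stub_exists_minimalDatum k K O B hB hNoeth hFracB
    have hJ := stub_singIdeal_locAt k K O₁ B hB₁ hEFT hFracB
    obtain ⟨b₁, d₁, ε₁, r₁, ι₁, x₁, ⟨hε₁, h0₁, hs₁, hι₁, htors₁⟩, hx0₁, hmin₁, hadj⟩ :=
      stub_localizedDatum k K O O₁ B hk hOO₁ hB hFracB hJ b d ε r ι x hε h0 hs hι htors hx0 hmin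
    -- both steps in canonical form
    have hL := locAt_step_eq O O₁ hOO₁ B hk hB b d ε r ι x hε h0 hs hι htors hx0 hmin
    have hlocB₁ : (locAt O₁ B).toSubring ≤ O₁.toSubring := locAt_le O₁ B hB₁
    have hR := locAt_step_eq O₁ O₁ le_rfl (locAt O₁ B) hk₁ hlocB₁ b₁ d₁ ε₁ r₁ ι₁ x₁ hε₁ h0₁ hs₁
      hι₁ htors₁ hx0₁ hmin₁
    -- the ratio sets lie in `O₁`, so the adjoined algebras do
    have hS : {y : K | ∃ g : Fin r → ↥(LinearMap.range (d (syzygyIndex k K - 1))),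
        y = Matrix.det (Matrix.of fun i j => ((ι (g i) j : ↥B) : K)) *
          (Matrix.det (Matrix.of fun i j => ((ι (x i) j : ↥B) : K)))⁻¹} ⊆ O := by
      rintro y ⟨g, rfl⟩
      exact hmin g
    have hS₁ : {y : K | ∃ g : Fin r₁ → ↥(LinearMap.range (d₁ (syzygyIndex k K - 1))),
        y = Matrix.det (Matrix.of fun i j => ((ι₁ (g i) j : ↥(locAt O₁ B)) : K)) *
          (Matrix.det (Matrix.of fun i j => ((ι₁ (x₁ i) j : ↥(locAt O₁ B)) : K)))⁻¹} ⊆ O₁ := by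
      rintro y ⟨g, rfl⟩
      exact hmin₁ g
    have hadjO₁ := adjoin_ratios_le O O₁ hOO₁ B hk hB _ hS
    have hadj₁O₁ := adjoin_ratios_le O₁ O₁ le_rfl (locAt O₁ B) hk₁ hlocB₁ _ hS₁
    -- stage `m + 1` of the `O₁`-tower is `step O₁ (tower O₁ A m) = step O₁ (locAt O₁ B)`
    have hfix₁ : locAt O₁ (step O₁ (locAt O₁ B)) = step O₁ (locAt O₁ B) :=
      locAt_locAt O₁ _ (nrm_toSubring_le O₁ hk₁ (chart_toSubring_le O₁ hk₁ hlocB₁))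
    rw [tower_succ', tower_succ', ← hBdef, ← ih, ← hfix₁, hL, hR,
      ← stub_nrm_locAt k K O₁ _ hk₁ hadj₁O₁, hadj, stub_nrm_locAt k K O₁ _ hk₁ hadjO₁]

end towerLocalisation

/-- **Registered `stub_towerLocalisation`**, a theorem of this file modulo the wave-2 stubs:
the operator commutes with coarsening. [cite: NovacoskiSpivakovsky2014, Lemma 2.5 (1)] -/
theorem stub_towerLocalisation : ∀ (k K : Type) [Field k] [Field K] [Algebra k K]
    (O : ValuationSubring K) (A : Subalgebra k K), (∀ c : k, algebraMap k K c ∈ O) → A.FG →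
      IsFractionRing ↥A K → A.toSubring ≤ O.toSubring →
      ∀ O₁ : ValuationSubring K, O ≤ O₁ → ∀ m : ℕ, locAt O₁ (tower O A m) = tower O₁ A m :=
  fun _ _ _ _ _ O A hk hFG hFrac hAO O₁ hOO₁ m => towerLocalisation O A hk hFG hFrac hAO O₁ hOO₁ m

section glue2

variable {k K : Type} [Field k] [Field K] [Algebra k K]

/-- **Termination along a coarsening `O₁ ⊇ O` ⇒ eventual persistent regularity of the
`O`-tower at the centre of `O₁`** (v1's `stub_coarseningLocalisation`, PROVED from
`stub_towerLocalisation`, `stub_regularStep`, `stub_towerStage_basic`, `stub_locAt_locAt`).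
[cite: NovacoskiSpivakovsky2014, Cor. 2.14 (existential shadow)] -/
theorem eventuallyRegularAlong_of_towerTerminates (O : ValuationSubring K) (A : Subalgebra k K)
    (hk : ∀ c : k, algebraMap k K c ∈ O) (hFG : A.FG) (hFrac : IsFractionRing ↥A K)
    (hAO : A.toSubring ≤ O.toSubring) (O₁ : ValuationSubring K) (hOO₁ : O ≤ O₁)
    (hterm : TowerTerminates O₁ A) : EventuallyRegularAlong O A O₁ := by
  obtain ⟨m₁, hreg⟩ := hterm
  have hk₁ : ∀ c : k, algebraMap k K c ∈ O₁ := fun c => hOO₁ (hk c)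
  have hAO₁ : A.toSubring ≤ O₁.toSubring := fun x hx => hOO₁ (hAO hx)
  refine ⟨m₁, fun m hm => ?_⟩
  show IsRegularLocalRing ↥(locAt O₁ (tower O A m))
  obtain ⟨j, rfl⟩ := Nat.exists_eq_add_of_le hm
  rw [stub_towerLocalisation k K O A hk hFG hFrac hAO O₁ hOO₁ (m₁ + j),
    tower_eq_of_regular O₁ A hk₁ hFrac hAO₁ m₁ hreg j]
  exact hreg

end glue2


end Summit.ResolutionOfSingularities.ResolutionOfSingularities.Theorems.SyzygyFlattening

end
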